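import Literature.AlgebraicGeometry.Resolution.MuPTorsorLocalUniformizationCore
import Literature.AlgebraicGeometry.Resolution.RankOneReductionProofs
import Literature.AlgebraicGeometry.Resolution.LocalBlowup
import Literature.AlgebraicGeometry.Resolution.RegularLocalRingsNormal
import HarnessLib

/-!
# The core `μ_p`-torsor step in relative (model) form, and reduction to rank-one valuations

**Sources.** M. Temkin, *Inseparable local uniformization*, J. Algebra **373** (2013) 65–119,
arXiv:0804.1554, Thm. 1.3.2 (relative, smooth form; named facts `Temkin2013Relative`, and its
height-one case `Temkin2013HeightLeOne` = §4.1) and Rem. 1.3.5 (ii); J. Novacoski,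
M. Spivakovsky, *Reduction of local uniformization to the rank one case*, EMS Ser. Congr. Rep.
(2014), arXiv:1204.4751, Thm. 1.1 (PROVED in the tree: `NovacoskiSpivakovsky2014_holds`);
S. D. Cutkosky, *Local uniformization of Abhyankar valuations*, Michigan Math. J. **71** (2022),
Thm. 1.3 (PROVED in the tree: `Cutkosky2022_Thm13_holds`); V. Cossart, O. Piltant, *Resolution
of singularities of arithmetical threefolds*, J. Algebra **529** (2019), Thm. 1.1 with §4.1
(named fact, here through `CossartPiltant2019LU3`); H. Matsumura, *Commutative ring theory*,
Thm. 19.4 (regular ⇒ normal, PROVED in the tree).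

**What is recorded (a combination; no new named fact).** The `μ_p`-torsor step of
`MuPTorsorLocalUniformizationCore` is re-typed in the RELATIVE vocabulary of
Novacoski–Spivakovsky / Cossart–Piltant (`RelLocalUniformization`: a prescribed finitely
generated model is DOMINATED by a regular one): `RelMuPTorsorCoreStepsAt p k O` says that a
finitely generated `A₀ ⊆ O`, regular at the centre of `O`, and a genuinely new `p`-th root
`a ∉ Frac A₀`, `a^p ∈ A₀`, with `trdeg_k Frac A₀(a) > 3` and `O ∩ Frac A₀(a)` non-Abhyankar,
are dominated by a finitely generated `A ∋ a`, `A₀ ⊆ A ⊆ O ∩ Frac A₀(a)`, regular at the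
centre of `O` ("relative uniformization of `μ_p`-torsors over regular local rings along
non-Abhyankar valuations in dimension `≥ 4`").

* `relLocalUniformization_of_relStepsAt_of_temkinAt` — Temkin's relative conclusion at `O`
  (for every affine model) + the model-form steps at `O` ⇒ `RelLocalUniformization k K O`, over
  an ARBITRARY ground field of characteristic `p` (Frobenius twist of the smooth `l`-model as in
  `MuPTorsorLocalUniformizationAllFields`, then a finite tower of model-form steps adjoining the
  `p^j`-th powers of the generators of the prescribed model);
* `relStepsAt_of_relCoreStepsAt` — the non-core steps are theorems: `a ∈ Frac A₀` by normality
  of regular local rings (Matsumura 19.4), `trdeg ≤ 3` by Cossart–Piltant, Abhyankar places by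
  Cutkosky;
* `relStepsAt_of_relLocalUniformization` — conversely relative local uniformization of the
  valuation rings `O ∩ K'`, `K' ⊆ K`, gives all steps;
* `ringKrullDim_le_one_of_rankOne` — a rank-one valuation ring has Krull dimension `≤ 1`, so
  `Temkin2013HeightLeOne` applies to it; with Novacoski–Spivakovsky's Thm. 1.1 (proved):
  `relLocalUniformization_of_rankOne_relCoreSteps` — the core steps at the RANK-ONE valuation
  rings over `k` already give relative local uniformization of every valuation ring over `k`,
  and `relLocalUniformization_iff_rankOne_relCoreSteps` — granted `Temkin2013HeightLeOne` and
  `CossartPiltant2019LU3`, relative local uniformization in characteristic `p` is EQUIVALENT to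
  the core steps at rank-one valuation rings over all ground fields of characteristic `p`.
-/

noncomputable section

open IsLocalRing TensorProduct

namespace Literature.AlgebraicGeometry.Resolution

/-! ## Rank-one valuation rings have Krull dimension `≤ 1` -/

section RankOne

variable {K : Type*} [Field K]

/-- The overrings of a rank-one valuation ring `O` of `K` are `O` and `K` (the value group is
archimedean). [folklore] -/
theorem eq_self_or_eq_top_of_le_of_rankOne (O : ValuationSubring K)
    (hr : Nonempty O.valuation.RankOne) (S : ValuationSubring K) (hOS : O ≤ S) :
    S = O ∨ S = ⊤ := by
  classical
  obtain ⟨hr⟩ := hr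
  haveI : O.valuation.IsNontrivial := hr.toIsNontrivial
  have hM : MulArchimedean
      (MonoidWithZeroHom.ValueGroup₀ (MonoidWithZeroHom.ofClass O.valuation)) :=
    Valuation.nonempty_rankOne_iff_mulArchimedean.mp ⟨hr⟩
  by_cases hSO : S ≤ O
  · exact Or.inl (le_antisymm hSO hOS)
  right
  obtain ⟨x, hxS, hxO⟩ : ∃ x ∈ S, x ∉ O := Set.not_subset.mp hSO
  rw [eq_top_iff]
  intro y _
  by_cases hyO : y ∈ O
  · exact hOS hyO
  have hx1 : 1 < O.valuation x := by
    rw [← not_le]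
    exact fun h => hxO ((O.valuation_le_one_iff x).mp h)
  have hx1' : O.valuation.restrict 1 < O.valuation.restrict x :=
    O.valuation.restrict_lt_iff.mpr (by rwa [map_one])
  rw [map_one] at hx1'
  obtain ⟨n, hn⟩ := MulArchimedean.arch (O.valuation.restrict y) hx1'
  rw [← map_pow] at hn
  have hn' : O.valuation y ≤ O.valuation (x ^ n) := O.valuation.restrict_le_iff.mp hn
  have hx0 : x ≠ 0 := by
    rintro rfl
    exact hxO O.zero_mem
  have hmem : y / x ^ n ∈ O := by
    rw [← O.valuation_le_one_iff, map_div₀]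
    exact div_le_one_of_le₀ hn' zero_le
  have hy : y = y / x ^ n * x ^ n := by rw [div_mul_cancel₀ _ (pow_ne_zero n hx0)]
  rw [hy]
  exact mul_mem (hOS hmem) (pow_mem hxS n)

/-- A rank-one valuation ring has dimension `≤ 1`: every nonzero prime is maximal (primes
correspond to overrings). [folklore] -/
theorem dimensionLEOne_of_rankOne (O : ValuationSubring K) (hr : Nonempty O.valuation.RankOne) :
    Ring.DimensionLEOne O := by
  refine ⟨fun {q} hq0 hq => ?_⟩
  by_contra hmax
  have hne : q ≠ maximalIdeal O := fun h => hmax (h ▸ IsLocalRing.maximalIdeal.isMaximal O)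
  rcases eq_self_or_eq_top_of_le_of_rankOne O hr (O.ofPrime q) (O.le_ofPrime q) with h | h
  · exact ofPrime_ne_self O q hne h
  · exact ofPrime_ne_top O q hq0 h

/-- A rank-one valuation ring has Krull dimension `≤ 1` (its height, Temkin 2013 §2.1, is `1`).
[folklore] -/
theorem ringKrullDim_le_one_of_rankOne (O : ValuationSubring K)
    (hr : Nonempty O.valuation.RankOne) : ringKrullDim O ≤ 1 := by
  haveI := dimensionLEOne_of_rankOne O hr
  exact Ring.krullDimLE_iff.mp inferInstance

end RankOne

/-! ## The torsor step in model form -/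

section Defs

variable (p : ℕ) (k : Type) {K : Type} [Field k] [Field K] [Algebra k K] (O : ValuationSubring K)

/-- **The `μ_p`-torsor step in MODEL (relative) form at the valuation ring `O` of `K ⊇ k`:**
every finitely generated `k`-subalgebra `A₀ ⊆ O`, regular at the centre `𝔪_O ∩ A₀`, and every
`a ∈ K` with `a^p ∈ A₀` are dominated by a finitely generated `A ⊆ O ∩ Frac A₀(a)` with
`A₀ ⊆ A ∋ a`, regular at the centre `𝔪_O ∩ A` (relative local uniformization of the valuation
`O ∩ Frac A₀(a)` of the `μ_p`-torsor `Spec A₀[a] → Spec A₀` over the regular local ring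
`(A₀)_{𝔪_O ∩ A₀}`). [cite: Temkin2013, Rem. 1.3.5 (ii)] -/
def RelMuPTorsorStepsAt : Prop :=
  ∀ (A₀ : Subalgebra k K) (h₀ : A₀.toSubring ≤ O.toSubring) (a : K), A₀.FG →
    IsRegularLocalRing
      (Localization.AtPrime (Ideal.comap (Subring.inclusion h₀) (maximalIdeal O))) →
    a ^ p ∈ A₀ →
    ∃ (A : Subalgebra k K) (h : A.toSubring ≤ O.toSubring), A₀ ≤ A ∧ a ∈ A ∧ A.FG ∧
      (A : Set K) ⊆ IntermediateField.adjoin k (insert a (A₀ : Set K)) ∧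
      IsRegularLocalRing
        (Localization.AtPrime (Ideal.comap (Subring.inclusion h) (maximalIdeal O)))

/-- **The CORE `μ_p`-torsor steps in model form** at `O`: the steps of `RelMuPTorsorStepsAt`
with `a ∉ Frac A₀` (a genuine `μ_p`-torsor), `trdeg_k Frac A₀(a) > 3` and `O ∩ Frac A₀(a)` NOT
an Abhyankar place of `Frac A₀(a) / k` — the remaining steps being theorems (normality of
regular local rings; Cossart–Piltant in dimension `≤ 3`; Cutkosky at Abhyankar places).
[cite: Temkin2013, Rem. 1.3.5 (ii)] -/
def RelMuPTorsorCoreStepsAt : Prop :=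
  ∀ (A₀ : Subalgebra k K) (h₀ : A₀.toSubring ≤ O.toSubring) (a : K), A₀.FG →
    IsRegularLocalRing
      (Localization.AtPrime (Ideal.comap (Subring.inclusion h₀) (maximalIdeal O))) →
    a ∉ IntermediateField.adjoin k (A₀ : Set K) → a ^ p ∈ A₀ →
    3 < Algebra.trdeg k ↥(IntermediateField.adjoin k (insert a (A₀ : Set K))) →
    ¬ IsAbhyankarPlace
        (O.comap (algebraMap ↥(IntermediateField.adjoin k (insert a (A₀ : Set K))) K))
        (algebraMap k ↥(IntermediateField.adjoin k (insert a (A₀ : Set K)))).fieldRange ⊤ →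
    ∃ (A : Subalgebra k K) (h : A.toSubring ≤ O.toSubring), A₀ ≤ A ∧ a ∈ A ∧ A.FG ∧
      (A : Set K) ⊆ IntermediateField.adjoin k (insert a (A₀ : Set K)) ∧
      IsRegularLocalRing
        (Localization.AtPrime (Ideal.comap (Subring.inclusion h) (maximalIdeal O)))

variable {p k O}

/-- All steps contain the core steps. [folklore] -/
theorem RelMuPTorsorStepsAt.core (H : RelMuPTorsorStepsAt p k O) : RelMuPTorsorCoreStepsAt p k O :=
  fun A₀ h₀ a hfg hreg _ hap _ _ => H A₀ h₀ a hfg hreg hap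

end Defs

/-! ## Bookkeeping: models, subfields, centres -/

section Transport

variable {k K : Type} [Field k] [Field K] [Algebra k K]

/-- `k ⊆ O` as soon as some `k`-subalgebra lies in `O`. [folklore] -/
theorem algebraMap_mem_of_le (O : ValuationSubring K) (A : Subalgebra k K)
    (h : A.toSubring ≤ O.toSubring) (c : k) : algebraMap k K c ∈ O :=
  h (A.algebraMap_mem c)

/-- `K = k(t)` for the generators `t` of any affine model. [folklore] -/
theorem fg_top_of_model (R : Subalgebra k K) (hfg : R.FG) (hfr : IsFractionRing R K) :
    (⊤ : IntermediateField k K).FG := by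
  obtain ⟨s, hs⟩ := hfg
  refine ⟨s, eq_top_iff.mpr fun x _ => ?_⟩
  haveI := hfr
  obtain ⟨a, b, -, rfl⟩ := IsFractionRing.div_surjective (A := R) x
  have hle : R ≤ (IntermediateField.adjoin k (s : Set K)).toSubalgebra := by
    rw [← hs]
    exact IntermediateField.algebra_adjoin_le_adjoin k _
  exact div_mem (hle a.2) (hle b.2)

/-- The `k`-subalgebra generated by a subset of `O` lies in `O` (when `k ⊆ O`). [folklore] -/
theorem adjoin_toSubring_le_of_subset_valuationSubring (O : ValuationSubring K) (hk : ∀ c : k, algebraMap k K c ∈ O)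
    {G : Set K} (hG : G ⊆ O) : (Algebra.adjoin k G).toSubring ≤ O.toSubring := by
  intro x hx
  rw [Algebra.adjoin_eq_ring_closure] at hx
  refine Subring.closure_le.mpr ?_ hx
  rintro z (⟨c, rfl⟩ | hz)
  · exact hk c
  · exact hG hz

/-- Elements of `k(G)` are quotients of elements of `k[G]`. [folklore] -/
theorem exists_div_of_mem_adjoin (G : Set K) (z : IntermediateField.adjoin k G) :
    ∃ a b : K, a ∈ Algebra.adjoin k G ∧ b ∈ Algebra.adjoin k G ∧ b ≠ 0 ∧ (z : K) = a / b := by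
  obtain ⟨r, hr, s, hs, hz⟩ := IntermediateField.mem_adjoin_iff_div.mp z.2
  by_cases hs0 : s = 0
  · refine ⟨0, 1, (Algebra.adjoin k G).zero_mem, (Algebra.adjoin k G).one_mem, one_ne_zero, ?_⟩
    rw [zero_div, hz, hs0, div_zero]
  · exact ⟨r, s, hr, hs, hs0, hz⟩

/-- **Going down.** A finitely generated `S ⊆ O` inside the subfield `K' = Frac S` of `K` is,
read in `K'`, an affine model of `O ∩ K'`. [folklore] -/
theorem comap_model (K' : IntermediateField k K) (O : ValuationSubring K) (S : Subalgebra k K)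
    (hSfg : S.FG) (hSO : S.toSubring ≤ O.toSubring) (hSK : (S : Set K) ⊆ K')
    (hfrac : ∀ z : K', ∃ a b : K, a ∈ S ∧ b ∈ S ∧ b ≠ 0 ∧ (z : K) = a / b) :
    (S.comap K'.val).FG ∧ IsFractionRing (S.comap K'.val) K' ∧
      (S.comap K'.val).toSubring ≤ (O.comap (algebraMap K' K)).toSubring ∧
      (S.comap K'.val).map K'.val = S := by
  have hfinj : Function.Injective K'.val := (K'.val : K' →+* K).injective
  have hAK : ∀ x ∈ S, x ∈ Set.range K'.val := fun x hx => ⟨⟨x, hSK hx⟩, rfl⟩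
  have hmap : (S.comap K'.val).map K'.val = S := by
    rw [Subalgebra.map_comap_eq]
    exact inf_eq_left.mpr fun x hx => hAK x hx
  refine ⟨Subalgebra.fg_of_fg_map _ K'.val hfinj (by rw [hmap]; exact hSfg), ?_,
    fun x hx => hSO hx, hmap⟩
  refine IsFractionRing.of_field (S.comap K'.val) K' fun z => ?_
  obtain ⟨a, b, ha, hb, -, hz⟩ := hfrac z
  obtain ⟨a₀, rfl⟩ := hAK a ha
  obtain ⟨b₀, rfl⟩ := hAK b hb
  refine ⟨⟨a₀, show K'.val a₀ ∈ S from ha⟩, ⟨b₀, show K'.val b₀ ∈ S from hb⟩, hfinj ?_⟩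
  rw [map_div₀]
  exact hz

/-- **Going up.** A `k`-subalgebra `A'` of the subfield `K' ⊆ K`, contained in `O ∩ K'` and
regular at its centre, is, read in `K`, contained in `O` and regular at the centre of `O`
(the two local rings are isomorphic). [folklore] -/
theorem map_model (K' : IntermediateField k K) (O : ValuationSubring K) (A' : Subalgebra k K')
    (h' : A'.toSubring ≤ (O.comap (algebraMap K' K)).toSubring)
    (hreg : IsRegularLocalRing (Localization.AtPrime
      (Ideal.comap (Subring.inclusion h') (maximalIdeal (O.comap (algebraMap K' K)))))) :
    ∃ h : (A'.map K'.val).toSubring ≤ O.toSubring, IsRegularLocalRing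
      (Localization.AtPrime (Ideal.comap (Subring.inclusion h) (maximalIdeal O))) := by
  classical
  have hfinj : Function.Injective K'.val := (K'.val : K' →+* K).injective
  have h : (A'.map K'.val).toSubring ≤ O.toSubring := by
    rintro _ ⟨y, hy, rfl⟩
    exact h' hy
  refine ⟨h, ?_⟩
  have hmapS : A'.toSubring.map (K'.val : K' →+* K) = (A'.map K'.val).toSubring := by
    ext z
    simp only [Subring.mem_map, Subalgebra.mem_toSubring, Subalgebra.mem_map]
    constructor
    · rintro ⟨x, hx, rfl⟩
      exact ⟨x, hx, rfl⟩
    · rintro ⟨x, hx, rfl⟩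
      exact ⟨x, hx, rfl⟩
  let e : A'.toSubring ≃+* (A'.map K'.val).toSubring :=
    (A'.toSubring.equivMapOfInjective (K'.val : K' →+* K) hfinj).trans
      (RingEquiv.subringCongr hmapS)
  have he : ∀ a : A'.toSubring, ((e a : (A'.map K'.val).toSubring) : K) = K'.val a :=
    fun a => rfl
  set P : Ideal (A'.map K'.val).toSubring := Ideal.comap (Subring.inclusion h) (maximalIdeal O)
    with hP
  haveI hPp : P.IsPrime := Ideal.comap_isPrime _ _
  have hPe : P.comap (e : A'.toSubring →+* (A'.map K'.val).toSubring) =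
      Ideal.comap (Subring.inclusion h') (maximalIdeal (O.comap (algebraMap K' K))) := by
    ext a
    have h2 : Subring.inclusion h (e a) = ⟨K'.val a, h (e a).2⟩ := Subtype.ext (he a)
    simp only [Ideal.mem_comap, hP, RingHom.coe_coe]
    rw [h2]
    exact (mk_mem_maximalIdeal_comap_iff O (algebraMap K' K) (h' a.2)).symm
  haveI : (P.comap (e : A'.toSubring →+* (A'.map K'.val).toSubring)).IsPrime :=
    Ideal.comap_isPrime _ _
  exact (isRegularLocalRing_localization_iff_of_ringEquiv e P).mpr
    (isRegularLocalRing_localization_atPrime_congr hPe.symm hreg)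

/-- **Relative local uniformization on a subfield yields models upstairs.** If `O ∩ K'`
(`K' ⊆ K` a subfield over `k`) satisfies relative local uniformization over `k`, then every
finitely generated `S ⊆ O` with `S ⊆ K' = Frac S` is dominated by a finitely generated
`A ⊆ O ∩ K'`, regular at the centre of `O`. [folklore] -/
theorem exists_model_of_relLU_subfield (K' : IntermediateField k K) (O : ValuationSubring K)
    (hLU : RelLocalUniformization k K' (O.comap (algebraMap K' K)))
    (S : Subalgebra k K) (hSfg : S.FG) (hSO : S.toSubring ≤ O.toSubring)
    (hSK : (S : Set K) ⊆ K')
    (hfrac : ∀ z : K', ∃ a b : K, a ∈ S ∧ b ∈ S ∧ b ≠ 0 ∧ (z : K) = a / b) :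
    ∃ (A : Subalgebra k K) (h : A.toSubring ≤ O.toSubring), S ≤ A ∧ A.FG ∧
      (A : Set K) ⊆ K' ∧
      IsRegularLocalRing
        (Localization.AtPrime (Ideal.comap (Subring.inclusion h) (maximalIdeal O))) := by
  obtain ⟨hfg', hfr', h₀', hmap⟩ := comap_model K' O S hSfg hSO hSK hfrac
  obtain ⟨A', h', hle, hA'fg, hreg⟩ := hLU (S.comap K'.val) hfg' hfr' h₀'
  obtain ⟨h, hreg'⟩ := map_model K' O A' h' hreg
  refine ⟨A'.map K'.val, h, ?_, hA'fg.map _, ?_, hreg'⟩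
  · rw [← hmap]
    exact Subalgebra.map_mono hle
  · rintro _ ⟨y, -, rfl⟩
    exact y.2

/-- **Relative local uniformization at Abhyankar places over any field** (Cutkosky 2022,
Thm. 1.3, proved in the tree, in the vocabulary of `RelLocalUniformization`).
[cite: Cutkosky2022, Thm. 1.3] -/
theorem relLocalUniformization_of_isAbhyankarPlace (hfg : (⊤ : IntermediateField k K).FG)
    (O : ValuationSubring K) (hk : ∀ c : k, algebraMap k K c ∈ O)
    (hA : IsAbhyankarPlace O (algebraMap k K).fieldRange ⊤) : RelLocalUniformization k K O := by
  intro R hRfg _ hRO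
  obtain ⟨A, h, hle, hAfg, -, hreg⟩ := Cutkosky2022_Thm13_holds k K hfg O hk hA R hRfg hRO
  exact ⟨A, h, hle, hAfg, hreg⟩

/-- **The trivial step** (`a ∈ Frac A₀`): if `A₀ ⊆ O` is regular at the centre and `a ∈ Frac A₀`
with `a^n ∈ A₀`, `n ≠ 0`, then `a` lies in the local ring of `A₀` at the centre — regular local
rings being normal (Matsumura, Thm. 19.4). [cite: Matsumura1987, Thm. 19.4] -/
theorem mem_locAtCentre_of_pow_mem (O : ValuationSubring K) (A₀ : Subalgebra k K)
    (h₀ : A₀.toSubring ≤ O.toSubring)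
    (hreg : IsRegularLocalRing
      (Localization.AtPrime (Ideal.comap (Subring.inclusion h₀) (maximalIdeal O))))
    {a : K} (ha : a ∈ IntermediateField.adjoin k (A₀ : Set K)) {n : ℕ} (hn : n ≠ 0)
    (han : a ^ n ∈ A₀) : a ∈ locAtCentre A₀.toSubring O := by
  classical
  set T := locAtCentre A₀.toSubring O with hT
  haveI hTreg : IsRegularLocalRing T := (isRegularLocalRing_locAtCentre_iff h₀).mpr hreg
  haveI : IsDomain T := inferInstance
  haveI := isIntegrallyClosed_of_isRegularLocalRing T
  obtain ⟨x, hx, y, hy, hxy⟩ := IntermediateField.mem_adjoin_iff_div.mp ha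
  rw [Algebra.adjoin_eq] at hx hy
  by_cases hy0 : y = 0
  · rw [hxy, hy0, div_zero]
    exact T.zero_mem
  have hxT : x ∈ T := le_locAtCentre _ O hx
  have hyT : y ∈ T := le_locAtCentre _ O hy
  have hanT : a ^ n ∈ T := le_locAtCentre _ O han
  have hdvd : (⟨y, hyT⟩ : T) ^ n ∣ (⟨x, hxT⟩ : T) ^ n := by
    refine ⟨⟨a ^ n, hanT⟩, Subtype.ext ?_⟩
    push_cast
    rw [hxy, div_pow, mul_div_cancel₀ _ (pow_ne_zero n hy0)]
  obtain ⟨t, ht⟩ := (IsIntegrallyClosed.pow_dvd_pow_iff hn).mp hdvd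
  have ht' : x = y * (t : K) := by
    have := congrArg (fun z : T => (z : K)) ht
    simpa using this
  have hat : a = t := by
    rw [hxy, ht', mul_div_cancel_left₀ _ hy0]
  rw [hat]
  exact t.2

/-- **The trivial step, model form:** under the hypotheses of `mem_locAtCentre_of_pow_mem`,
`A₀[a] ⊆ O` has the same local ring at the centre of `O` as `A₀`, hence is regular there.
[cite: Matsumura1987, Thm. 19.4] -/
theorem exists_model_adjoin_of_mem_adjoin (O : ValuationSubring K) (A₀ : Subalgebra k K)
    (h₀ : A₀.toSubring ≤ O.toSubring) (hA₀fg : A₀.FG)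
    (hreg : IsRegularLocalRing
      (Localization.AtPrime (Ideal.comap (Subring.inclusion h₀) (maximalIdeal O))))
    {a : K} (ha : a ∈ IntermediateField.adjoin k (A₀ : Set K)) {n : ℕ} (hn : n ≠ 0)
    (han : a ^ n ∈ A₀) :
    ∃ (A : Subalgebra k K) (h : A.toSubring ≤ O.toSubring), A₀ ≤ A ∧ a ∈ A ∧ A.FG ∧
      (A : Set K) ⊆ IntermediateField.adjoin k (insert a (A₀ : Set K)) ∧
      IsRegularLocalRing
        (Localization.AtPrime (Ideal.comap (Subring.inclusion h) (maximalIdeal O))) := by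
  classical
  have haT := mem_locAtCentre_of_pow_mem O A₀ h₀ hreg ha hn han
  set A : Subalgebra k K := Algebra.adjoin k (insert a (A₀ : Set K)) with hA
  have hA₀A : A₀ ≤ A := fun x hx => Algebra.subset_adjoin (Set.mem_insert_of_mem a hx)
  have haA : a ∈ A := Algebra.subset_adjoin (Set.mem_insert a _)
  have hAT : A.toSubring ≤ locAtCentre A₀.toSubring O := by
    intro x hx
    rw [hA, Algebra.adjoin_eq_ring_closure] at hx
    refine Subring.closure_le.mpr ?_ hx
    rintro z (⟨c, rfl⟩ | hz)
    · exact le_locAtCentre _ O (A₀.algebraMap_mem c)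
    · rcases hz with rfl | hz
      · exact haT
      · exact le_locAtCentre _ O hz
  have hAO : A.toSubring ≤ O.toSubring := hAT.trans (locAtCentre_le h₀)
  have hloc : locAtCentre A.toSubring O = locAtCentre A₀.toSubring O := by
    refine le_antisymm ?_ (locAtCentre_mono O (show A₀.toSubring ≤ A.toSubring from hA₀A))
    have h1 := locAtCentre_mono O hAT
    rwa [locAtCentre_locAtCentre] at h1
  have hAfg : A.FG := by
    obtain ⟨s, hs⟩ := hA₀fg
    have hA' : A = Algebra.adjoin k ↑(insert a s) := by
      rw [hA, Finset.coe_insert, ← hs, Algebra.adjoin_insert_adjoin]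
    rw [hA']
    exact Subalgebra.fg_adjoin_finset _
  have hT' : IsRegularLocalRing (locAtCentre A.toSubring O) := by
    rw [hloc]
    exact (isRegularLocalRing_locAtCentre_iff h₀).mpr hreg
  exact ⟨A, hAO, hA₀A, haA, hAfg, IntermediateField.algebra_adjoin_le_adjoin k _,
    (isRegularLocalRing_locAtCentre_iff hAO).mp hT'⟩

end Transport

/-! ## Core steps give all steps -/

section Steps

variable {p : ℕ} {k K : Type} [Field k] [Field K] [Algebra k K]

/-- **The core steps suffice**, over an arbitrary ground field, granted local uniformization in
dimension `≤ 3` (Cossart–Piltant 2019): the steps with `a ∈ Frac A₀` hold by normality of the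
regular local ring `(A₀)_{𝔪_O ∩ A₀}`, those with `trdeg_k Frac A₀(a) ≤ 3` by Cossart–Piltant
(relative form), those at Abhyankar places by Cutkosky 2022 (relative form, proved in the tree).
[cite: CossartPiltant2019, Thm. 1.1 with §4.1; Cutkosky2022, Thm. 1.3; Matsumura1987, Thm. 19.4] -/
theorem relStepsAt_of_relCoreStepsAt [hp : Fact p.Prime] (hCP : CossartPiltant2019LU3.{0})
    (O : ValuationSubring K) (hk : ∀ c : k, algebraMap k K c ∈ O)
    (H : RelMuPTorsorCoreStepsAt p k O) : RelMuPTorsorStepsAt p k O := by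
  classical
  intro A₀ h₀ a hA₀fg hreg hap
  by_cases ha : a ∈ IntermediateField.adjoin k (A₀ : Set K)
  · exact exists_model_adjoin_of_mem_adjoin O A₀ h₀ hA₀fg hreg ha hp.out.ne_zero hap
  -- the subfield `K' = Frac A₀(a)` and its model `S = A₀[a]`
  set G : Set K := insert a (A₀ : Set K) with hG
  set K' : IntermediateField k K := IntermediateField.adjoin k G with hK'
  set S : Subalgebra k K := Algebra.adjoin k G with hS
  have haO : a ∈ O := mem_of_pow_mem hp.out.ne_zero (h₀ hap)
  have hGO : G ⊆ O := Set.insert_subset haO fun x hx => h₀ hx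
  have hSO : S.toSubring ≤ O.toSubring := adjoin_toSubring_le_of_subset_valuationSubring O hk hGO
  have hA₀S : A₀ ≤ S := fun x hx => Algebra.subset_adjoin (Set.mem_insert_of_mem a hx)
  have haS : a ∈ S := Algebra.subset_adjoin (Set.mem_insert a _)
  have hSK : (S : Set K) ⊆ K' := IntermediateField.algebra_adjoin_le_adjoin k _
  have hfrac : ∀ z : K', ∃ x y : K, x ∈ S ∧ y ∈ S ∧ y ≠ 0 ∧ (z : K) = x / y :=
    exists_div_of_mem_adjoin G
  obtain ⟨s, hs⟩ := hA₀fg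
  have hSfg : S.FG := by
    have hS' : S = Algebra.adjoin k ↑(insert a s) := by
      rw [hS, hG, Finset.coe_insert, ← hs, Algebra.adjoin_insert_adjoin]
    rw [hS']
    exact Subalgebra.fg_adjoin_finset _
  -- `K'` is finitely generated over `k`, and `k ⊆ O ∩ K'`
  have hK'fg : K'.FG := by
    refine ⟨insert a s, le_antisymm ?_ ?_⟩
    · refine IntermediateField.adjoin.mono k _ _ ?_
      rw [Finset.coe_insert, hG]
      refine Set.insert_subset_insert ?_
      rw [← hs]
      exact Algebra.subset_adjoin
    · refine IntermediateField.adjoin_le_iff.mpr (Set.insert_subset ?_ ?_)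
      · exact IntermediateField.subset_adjoin k _ (by simp)
      · rw [← hs]
        refine (IntermediateField.algebra_adjoin_le_adjoin k (s : Set K)).trans ?_
        exact IntermediateField.adjoin.mono k _ _ (by simp)
  have hfg' : (⊤ : IntermediateField k K').FG := intermediateField_fg_top_of_fg _ hK'fg
  have hk' : ∀ c : k, algebraMap k K' c ∈ O.comap (algebraMap K' K) := fun c => by
    rw [ValuationSubring.mem_comap, ← IsScalarTower.algebraMap_apply]
    exact hk c
  have finish : RelLocalUniformization k K' (O.comap (algebraMap K' K)) →
      ∃ (A : Subalgebra k K) (h : A.toSubring ≤ O.toSubring), A₀ ≤ A ∧ a ∈ A ∧ A.FG ∧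
        (A : Set K) ⊆ K' ∧
        IsRegularLocalRing
          (Localization.AtPrime (Ideal.comap (Subring.inclusion h) (maximalIdeal O))) := by
    intro hLU
    obtain ⟨A, h, hSA, hAfg, hAK, hregA⟩ :=
      exists_model_of_relLU_subfield K' O hLU S hSfg hSO hSK hfrac
    exact ⟨A, h, hA₀S.trans hSA, hSA haS, hAfg, hAK, hregA⟩
  by_cases hd : Algebra.trdeg k K' ≤ 3
  · exact finish (CossartPiltant2019LU3.relLocalUniformization hCP k K' hd _)
  by_cases hAbh : IsAbhyankarPlace (O.comap (algebraMap K' K)) (algebraMap k K').fieldRange ⊤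
  · exact finish (relLocalUniformization_of_isAbhyankarPlace hfg' _ hk' hAbh)
  · exact H A₀ h₀ a ⟨s, hs⟩ hreg ha hap (lt_of_not_ge hd) hAbh

/-- **Conversely, relative local uniformization of the valuation rings `O ∩ K'` (`K' ⊆ K`) gives
all model-form steps at `O`** (apply it on `K' = Frac A₀(a)` to the model `A₀[a]`).
[folklore] -/
theorem relStepsAt_of_relLocalUniformization [hp : Fact p.Prime] (O : ValuationSubring K)
    (hk : ∀ c : k, algebraMap k K c ∈ O)
    (hLU : ∀ K' : IntermediateField k K, RelLocalUniformization k K' (O.comap (algebraMap K' K))) :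
    RelMuPTorsorStepsAt p k O := by
  classical
  intro A₀ h₀ a hA₀fg _ hap
  set G : Set K := insert a (A₀ : Set K) with hG
  set S : Subalgebra k K := Algebra.adjoin k G with hS
  have haO : a ∈ O := mem_of_pow_mem hp.out.ne_zero (h₀ hap)
  have hGO : G ⊆ O := Set.insert_subset haO fun x hx => h₀ hx
  have hSO : S.toSubring ≤ O.toSubring := adjoin_toSubring_le_of_subset_valuationSubring O hk hGO
  have hA₀S : A₀ ≤ S := fun x hx => Algebra.subset_adjoin (Set.mem_insert_of_mem a hx)
  have haS : a ∈ S := Algebra.subset_adjoin (Set.mem_insert a _)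
  have hSfg : S.FG := by
    obtain ⟨s, hs⟩ := hA₀fg
    have hS' : S = Algebra.adjoin k ↑(insert a s) := by
      rw [hS, hG, Finset.coe_insert, ← hs, Algebra.adjoin_insert_adjoin]
    rw [hS']
    exact Subalgebra.fg_adjoin_finset _
  obtain ⟨A, h, hSA, hAfg, hAK, hregA⟩ :=
    exists_model_of_relLU_subfield (IntermediateField.adjoin k G) O (hLU _) S hSfg hSO
      (IntermediateField.algebra_adjoin_le_adjoin k _) (exists_div_of_mem_adjoin G)
  exact ⟨A, h, hA₀S.trans hSA, hSA haS, hAfg, hAK, hregA⟩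

end Steps

/-! ## The tower and the main theorem -/

section Main

variable {p : ℕ} {k K : Type} [Field k] [Field K] [Algebra k K]

/-- **The tower of model-form steps.** If the steps hold at `O`, a finitely generated `B ⊆ O`
regular at the centre and finitely many `x` with `x^{p^n} ∈ B` are dominated by a finitely
generated `A ⊆ O` containing them, regular at the centre (induction on `n`, adjoining the
`p`-th powers first, then the elements one at a time). [folklore] -/
theorem exists_model_of_relStepsAt_tower (O : ValuationSubring K) (H : RelMuPTorsorStepsAt p k O)
    (n : ℕ) : ∀ (B : Subalgebra k K) (hB : B.toSubring ≤ O.toSubring), B.FG →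
      IsRegularLocalRing
        (Localization.AtPrime (Ideal.comap (Subring.inclusion hB) (maximalIdeal O))) →
      ∀ t : Finset K, (∀ x ∈ t, x ^ p ^ n ∈ B) →
      ∃ (A : Subalgebra k K) (h : A.toSubring ≤ O.toSubring), B ≤ A ∧ (↑t : Set K) ⊆ A ∧ A.FG ∧
        IsRegularLocalRing
          (Localization.AtPrime (Ideal.comap (Subring.inclusion h) (maximalIdeal O))) := by
  classical
  induction n with
  | zero =>
    intro B hB hBfg hreg t ht
    exact ⟨B, hB, le_rfl, fun x hx => by simpa using ht x hx, hBfg, hreg⟩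
  | succ n ih =>
    intro B hB hBfg hreg t ht
    obtain ⟨A₁, h₁, hBA₁, ht₁, hA₁fg, hreg₁⟩ := ih B hB hBfg hreg (t.image fun x => x ^ p) (by
      intro y hy
      obtain ⟨x, hx, rfl⟩ := Finset.mem_image.mp hy
      rw [← pow_mul, ← pow_succ']
      exact ht x hx)
    have key : ∀ s : Finset K, s ⊆ t →
        ∃ (A : Subalgebra k K) (h : A.toSubring ≤ O.toSubring), A₁ ≤ A ∧ (↑s : Set K) ⊆ A ∧
          A.FG ∧ IsRegularLocalRing
            (Localization.AtPrime (Ideal.comap (Subring.inclusion h) (maximalIdeal O))) := by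
      intro s
      induction s using Finset.induction_on with
      | empty => exact fun _ => ⟨A₁, h₁, le_rfl, by simp, hA₁fg, hreg₁⟩
      | insert x s hxs ihs =>
        intro hst
        obtain ⟨A, h, hA₁A, hsA, hAfg, hregA⟩ := ihs ((Finset.subset_insert x s).trans hst)
        have hxp : x ^ p ∈ A :=
          hA₁A (ht₁ (Finset.mem_coe.mpr (Finset.mem_image_of_mem _ (hst (Finset.mem_insert_self x s)))))
        obtain ⟨A', h', hAA', hxA', hA'fg, -, hregA'⟩ := H A h x hAfg hregA hxp
        refine ⟨A', h', hA₁A.trans hAA', ?_, hA'fg, hregA'⟩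
        rw [Finset.coe_insert]
        exact Set.insert_subset hxA' (hsA.trans hAA')
    obtain ⟨A, h, hA₁A, htA, hAfg, hregA⟩ := key t subset_rfl
    exact ⟨A, h, hBA₁.trans hA₁A, htA, hAfg, hregA⟩

open Literature.AlgebraicGeometry.CossartPiltant200819.CP2008 in
/-- The image of an injective `k`-map `Φ : D → K` from a formally smooth finitely presented
`k`-algebra with `Φ(D) ⊆ O` is a finitely generated model, regular at the centre of `O`
(smooth over a field implies regular). [folklore] -/
theorem range_model_of_formallySmooth {D : Type} [CommRing D] [Algebra k D]
    [Algebra.FormallySmooth k D] [Algebra.FinitePresentation k D] (Φ : D →ₐ[k] K)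
    (hΦ : Function.Injective Φ) (O : ValuationSubring K) (hO : ∀ x, Φ x ∈ O) :
    ∃ h : Φ.range.toSubring ≤ O.toSubring, Φ.range.FG ∧ IsRegularLocalRing
      (Localization.AtPrime (Ideal.comap (Subring.inclusion h) (maximalIdeal O))) := by
  classical
  have hBO : Φ.range.toSubring ≤ O.toSubring := by
    rintro x ⟨y, rfl⟩
    exact hO y
  let e : D ≃ₐ[k] Φ.range := AlgEquiv.ofInjective Φ hΦ
  have hBfg : Φ.range.FG :=
    (Subalgebra.fg_iff_finiteType _).mpr (Algebra.FiniteType.equiv inferInstance e)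
  refine ⟨hBO, hBfg, ?_⟩
  let e' : D ≃+* ↥Φ.range.toSubring := e.toRingEquiv.trans (subalgebraRingEquivToSubring Φ.range)
  rw [isRegularLocalRing_localization_iff_of_ringEquiv e']
  exact isRegularLocalRing_of_isSmoothAt k D _

set_option maxHeartbeats 400000 in
/-- **Relative local uniformization from the model-form torsor steps**, over an ARBITRARY ground
field of characteristic `p`, granted Temkin's relative conclusion at `O` for every affine model.
Given `R ⊆ O` finitely generated with `Frac R = K`: Temkin (Thm. 1.3.2) refines `R ⊆ A'` and
gives `L ⊇ K`, `l ⊇ k` finite purely inseparable and the `l`-smooth model `N = Nr_L(A') ⊇ R` of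
`O_L`; shrinking to a smooth basic open `N_g` and twisting by the `p^n`-th power maps
`φ : L → K`, `ψ : l → k` (`frobeniusTwist_injective`), `B = Φ(k ⊗_l N_g) ⊆ O` is a finitely
generated model, regular at the centre of `O`, containing `φ(r) = r^{p^n}` for every `r ∈ R`.
The tower of steps (`exists_model_of_relStepsAt_tower`) applied to the generators of `R` then
yields a finitely generated `A ⊇ B ∪ R` inside `O`, regular at the centre.
[cite: Temkin2013, Thm. 1.3.2 and Rem. 1.3.5 (ii)] -/
theorem relLocalUniformization_of_relStepsAt_of_temkinAt [hp : Fact p.Prime] [CharP k p]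
    (O : ValuationSubring K)
    (hT : ∀ A : Subalgebra k K, A.toSubring ≤ O.toSubring → A.FG → IsFractionRing A K →
      Temkin2013RelConclusion k K O A)
    (H : RelMuPTorsorStepsAt p k O) : RelLocalUniformization k K O := by
  classical
  intro R hRfg hRfr hRO
  have hk : ∀ c : k, algebraMap k K c ∈ O := algebraMap_mem_of_le O R hRO
  obtain ⟨L, _, _, _, _, hfin, hpi, l, hlfin, hlpi, A', hRA', -, -, -, O', hO', N, hN, hNint,
    hNfg, hNfr, hsm, -, -⟩ := hT R hRO hRfg hRfr
  haveI := hfin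
  haveI := hpi
  haveI := hlfin
  haveI := hlpi
  obtain ⟨n, φ, ψ, hφL, hφK, hψ, hψk⟩ := exists_frobeniusData (p := p) (k := k) (K := K) l
  have hφO : ∀ x : L, x ∈ O' → φ x ∈ O := by
    intro x hx
    rw [← hO', ValuationSubring.mem_comap, hφL]
    exact pow_mem hx _
  -- `k` and `K` as `l`-algebras through `ψ`
  letI : Algebra l k := ψ.toAlgebra
  letI : Algebra l K := ((algebraMap k K).comp ψ).toAlgebra
  haveI : IsScalarTower l k K := IsScalarTower.of_algebraMap_eq fun _ => rfl
  -- a smooth neighbourhood `N_g` of the centre of `O'` on `N`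
  haveI : Algebra.FiniteType k N := (Subalgebra.fg_iff_finiteType _).mp hNfg
  haveI : Algebra.FiniteType l N := Algebra.FiniteType.of_restrictScalars_finiteType k l N
  obtain ⟨g, hg, hNg⟩ := exists_formallySmooth_away (centreIdeal N O' hN) hsm
  haveI := hNg
  haveI : Algebra.FinitePresentation l N := (Algebra.FinitePresentation.of_finiteType).mp ‹_›
  haveI : Algebra.FinitePresentation N (Localization.Away g) :=
    IsLocalization.Away.finitePresentation g
  haveI : Algebra.FinitePresentation l (Localization.Away g) :=
    Algebra.FinitePresentation.trans l N (Localization.Away g)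
  have hg0 : (g : L) ≠ 0 := fun h0 => by
    apply hg
    have : g = 0 := Subtype.ext h0
    rw [this]
    exact (centreIdeal N O' hN).zero_mem
  -- `g⁻¹ ∈ O'`, hence `φ(g)⁻¹ ∈ O`
  have hginv : ((g : L))⁻¹ ∈ O' := by
    have hgu : IsUnit (⟨(g : L), hN g.2⟩ : O') := by
      by_contra hnu
      exact hg ((IsLocalRing.mem_maximalIdeal _).mpr hnu)
    obtain ⟨u, hu⟩ := hgu
    have h1 : ((u⁻¹ : (O')ˣ) : O') * ⟨(g : L), hN g.2⟩ = 1 := by rw [← hu, Units.inv_mul]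
    have h2 : (((u⁻¹ : (O')ˣ) : O') : L) * (g : L) = 1 := by
      have := congrArg (fun z : O' => (z : L)) h1
      simpa using this
    rw [inv_eq_of_mul_eq_one_left h2]
    exact SetLike.coe_mem _
  have hφginv : (φ g)⁻¹ ∈ O := by
    rw [← map_inv₀]
    exact hφO _ hginv
  -- `χ = φ` on `N_g`, an injective `l`-algebra map to `O ⊆ K`
  obtain ⟨φN, hφN⟩ : ∃ φN : N →ₐ[l] K, ∀ x : N, φN x = φ x :=
    ⟨{ φ.comp (N.val : N →+* L) with commutes' := fun c => (hψ c).symm }, fun _ => rfl⟩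
  have hφNg : φN g ≠ 0 := by
    rw [hφN, map_ne_zero φ]
    exact hg0
  obtain ⟨χ, hχN, hχz, hχinj⟩ := exists_algHom_away φN g hφNg
  replace hχinj : Function.Injective χ :=
    hχinj fun x y hxy => Subtype.ext (φ.injective (by rw [← hφN, ← hφN, hxy]))
  have hχO : ∀ z, χ z ∈ O := by
    intro z
    obtain ⟨x, i, hz⟩ := hχz z
    rw [hz, hφN, hφN]
    exact O.mul_mem _ _ (hφO _ (hN x.2)) (pow_mem hφginv i)
  -- the twisted model `Φ : D = k ⊗_l N_g → K`, `B = Φ(D)`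
  haveI : Algebra.FinitePresentation k (k ⊗[l] Localization.Away g) :=
    Algebra.FinitePresentation.baseChange k
  have hψ' : ∀ c : k, ∃ c' : l, algebraMap l k c' = c ^ p ^ n := fun c =>
    ⟨algebraMap k l c, hψk c⟩
  have hΦinj := frobeniusTwist_injective (K := K) n hψ' χ hχinj
  set Φ := Algebra.TensorProduct.lift (Algebra.ofId k K) χ fun _ _ => Commute.all _ _ with hΦ
  obtain ⟨hBO, hBfg, hBreg⟩ :=
    range_model_of_formallySmooth Φ hΦinj O (tensorLift_mem χ O hk hχO)
  -- `r^{p^n} = φ(r) ∈ B` for `r ∈ R ⊆ A' ⊆ N`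
  have hRN : ∀ r ∈ R, algebraMap K L r ∈ N := by
    intro r hr
    have hmem : algebraMap K L r ∈ A'.map (IsScalarTower.toAlgHom k K L) :=
      Subalgebra.mem_map.mpr ⟨r, hRA' hr, rfl⟩
    have h1 : algebraMap K L r ∈ (N : Set L) := by
      rw [hNint]
      exact isIntegral_algebraMap (R := ↥(A'.map (IsScalarTower.toAlgHom k K L)))
        (x := ⟨algebraMap K L r, hmem⟩)
    exact h1
  have hRB : ∀ r ∈ R, r ^ p ^ n ∈ Φ.range := by
    intro r hr
    have h1 : Φ (1 ⊗ₜ algebraMap N (Localization.Away g) ⟨algebraMap K L r, hRN r hr⟩) =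
        r ^ p ^ n := by
      rw [hΦ, Algebra.TensorProduct.lift_tmul, map_one, one_mul, hχN, hφN]
      exact hφK r
    rw [← h1]
    exact AlgHom.mem_range_self _ _
  -- the tower over the generators of `R`
  obtain ⟨t, ht⟩ := hRfg
  obtain ⟨A, h, -, htA, hAfg, hregA⟩ :=
    exists_model_of_relStepsAt_tower O H n Φ.range hBO hBfg hBreg t fun x hx =>
      hRB x (by rw [← ht]; exact Algebra.subset_adjoin hx)
  refine ⟨A, h, ?_, hAfg, hregA⟩
  rw [← ht]
  exact Algebra.adjoin_le htA

/-- **Relative local uniformization from the model-form steps**, granted Temkin's relative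
theorem `Temkin2013Relative` (every ground field of characteristic `p`).
[cite: Temkin2013, Thm. 1.3.2 and Rem. 1.3.5 (ii)] -/
theorem relLocalUniformization_of_relStepsAt [Fact p.Prime] [CharP k p]
    (hT : Temkin2013Relative.{0}) (O : ValuationSubring K) (H : RelMuPTorsorStepsAt p k O) :
    RelLocalUniformization k K O := by
  intro R hRfg hRfr hRO
  have hk : ∀ c : k, algebraMap k K c ∈ O := algebraMap_mem_of_le O R hRO
  have hfg : (⊤ : IntermediateField k K).FG := fg_top_of_model R hRfg hRfr
  exact relLocalUniformization_of_relStepsAt_of_temkinAt O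
    (fun A hA hAfg hAfr => hT k K hfg O hk A hA hAfg hAfr) H R hRfg hRfr hRO

/-- **Relative local uniformization of a RANK-ONE valuation ring from its model-form steps**,
granted only the height-one case `Temkin2013HeightLeOne` of Temkin's theorem (a rank-one
valuation ring has Krull dimension `≤ 1`). [cite: Temkin2013, Section 4.1 (Thm. 4.1.1, n = 1)] -/
theorem relLocalUniformization_of_relStepsAt_of_rankOne [Fact p.Prime] [CharP k p]
    (hT₁ : Temkin2013HeightLeOne.{0}) (O : ValuationSubring K)
    (hr : Nonempty O.valuation.RankOne) (H : RelMuPTorsorStepsAt p k O) :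
    RelLocalUniformization k K O := by
  intro R hRfg hRfr hRO
  have hk : ∀ c : k, algebraMap k K c ∈ O := algebraMap_mem_of_le O R hRO
  have hfg : (⊤ : IntermediateField k K).FG := fg_top_of_model R hRfg hRfr
  exact relLocalUniformization_of_relStepsAt_of_temkinAt O
    (fun A hA hAfg hAfr => hT₁ k K hfg O hk (ringKrullDim_le_one_of_rankOne O hr) A hA hAfg hAfr)
    H R hRfg hRfr hRO

/-- **Relative local uniformization from the CORE steps** (Temkin relative + Cossart–Piltant in
dimension `≤ 3` + Cutkosky at Abhyankar places), every ground field of characteristic `p`.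
[cite: Temkin2013, Rem. 1.3.5 (ii); CossartPiltant2019, Thm. 1.1; Cutkosky2022, Thm. 1.3] -/
theorem relLocalUniformization_of_relCoreStepsAt [Fact p.Prime] [CharP k p]
    (hT : Temkin2013Relative.{0}) (hCP : CossartPiltant2019LU3.{0}) (O : ValuationSubring K)
    (hk : ∀ c : k, algebraMap k K c ∈ O) (H : RelMuPTorsorCoreStepsAt p k O) :
    RelLocalUniformization k K O :=
  relLocalUniformization_of_relStepsAt hT O (relStepsAt_of_relCoreStepsAt hCP O hk H)

/-- **Relative local uniformization of a rank-one valuation ring from its CORE steps**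
(Temkin height one + Cossart–Piltant in dimension `≤ 3` + Cutkosky at Abhyankar places).
[cite: Temkin2013, Section 4.1; CossartPiltant2019, Thm. 1.1; Cutkosky2022, Thm. 1.3] -/
theorem relLocalUniformization_of_relCoreStepsAt_of_rankOne [Fact p.Prime] [CharP k p]
    (hT₁ : Temkin2013HeightLeOne.{0}) (hCP : CossartPiltant2019LU3.{0}) (O : ValuationSubring K)
    (hr : Nonempty O.valuation.RankOne) (hk : ∀ c : k, algebraMap k K c ∈ O)
    (H : RelMuPTorsorCoreStepsAt p k O) : RelLocalUniformization k K O :=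
  relLocalUniformization_of_relStepsAt_of_rankOne hT₁ O hr (relStepsAt_of_relCoreStepsAt hCP O hk H)

end Main

/-! ## Reduction to rank one (Novacoski–Spivakovsky) and global statements -/

section Global

variable {p : ℕ}

/-- **The core steps at RANK-ONE valuation rings over `k` give relative local uniformization of
every valuation ring over `k`** (Novacoski–Spivakovsky 2014, Thm. 1.1, proved in the tree;
Temkin height one; Cossart–Piltant in dimension `≤ 3`; Cutkosky at Abhyankar places).
[cite: NovacoskiSpivakovsky2014, Thm. 1.1; Temkin2013, Section 4.1; CossartPiltant2019, Thm. 1.1; Cutkosky2022, Thm. 1.3] -/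
theorem relLocalUniformization_of_rankOne_relCoreSteps [Fact p.Prime]
    (hT₁ : Temkin2013HeightLeOne.{0}) (hCP : CossartPiltant2019LU3.{0}) {k : Type} [Field k]
    [CharP k p]
    (H : ∀ (K : Type) [Field K] [Algebra k K], (⊤ : IntermediateField k K).FG →
      ∀ O : ValuationSubring K, Nonempty O.valuation.RankOne →
        (∀ c : k, algebraMap k K c ∈ O) → RelMuPTorsorCoreStepsAt p k O)
    (K : Type) [Field K] [Algebra k K] (O : ValuationSubring K) :
    RelLocalUniformization k K O := by
  refine NovacoskiSpivakovsky2014_holds k (fun K _ _ O hr => ?_) K O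
  intro R hRfg hRfr hRO
  have hk : ∀ c : k, algebraMap k K c ∈ O := algebraMap_mem_of_le O R hRO
  have hfg : (⊤ : IntermediateField k K).FG := fg_top_of_model R hRfg hRfr
  exact relLocalUniformization_of_relCoreStepsAt_of_rankOne hT₁ hCP O hr hk (H K hfg O hr hk)
    R hRfg hRfr hRO

/-- Relative local uniformization of every valuation ring `O ∩ K'` over `k` gives the core steps
at `O` (unconditionally). [folklore] -/
theorem relCoreStepsAt_of_relLocalUniformization [Fact p.Prime] {k K : Type} [Field k]
    [Field K] [Algebra k K] (O : ValuationSubring K) (hk : ∀ c : k, algebraMap k K c ∈ O)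
    (hLU : ∀ K' : IntermediateField k K, RelLocalUniformization k K' (O.comap (algebraMap K' K))) :
    RelMuPTorsorCoreStepsAt p k O :=
  (relStepsAt_of_relLocalUniformization O hk hLU).core

/-- Relative local uniformization implies weak local uniformization (`IsLocallyUniformizable`)
of a valuation ring of a finitely generated extension. [folklore] -/
theorem isLocallyUniformizable_of_relLocalUniformization {k K : Type} [Field k] [Field K]
    [Algebra k K] (hfg : (⊤ : IntermediateField k K).FG) (O : ValuationSubring K)
    (hk : ∀ c : k, algebraMap k K c ∈ O) (h : RelLocalUniformization k K O) :
    IsLocallyUniformizable k K O := by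
  obtain ⟨R, hRO, hRfg, hRfr⟩ := exists_affineModel k K hfg O hk
  obtain ⟨A, hA, hRA, hAfg, hreg⟩ := h R hRfg hRfr hRO
  haveI := hRfr
  haveI : IsFractionRing A K := by
    refine IsFractionRing.of_field A K fun z => ?_
    obtain ⟨a, b, -, rfl⟩ := IsFractionRing.div_surjective (A := R) z
    exact ⟨⟨a, hRA a.2⟩, ⟨b, hRA b.2⟩, rfl⟩
  exact ⟨A, hA, hAfg, this, hreg⟩

/-- **Relative local uniformization in characteristic `p` ⟺ the CORE `μ_p`-torsor steps in model
form at the RANK-ONE valuation rings**, over all ground fields of characteristic `p` — granted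
Temkin's height-one theorem and Cossart–Piltant's local uniformization in dimension `≤ 3`
(`⇒` is unconditional). [cite: NovacoskiSpivakovsky2014, Thm. 1.1; Temkin2013, Section 4.1; CossartPiltant2019, Thm. 1.1; Cutkosky2022, Thm. 1.3] -/
theorem relLocalUniformization_iff_rankOne_relCoreSteps [Fact p.Prime]
    (hT₁ : Temkin2013HeightLeOne.{0}) (hCP : CossartPiltant2019LU3.{0}) :
    (∀ (k K : Type) [Field k] [CharP k p] [Field K] [Algebra k K] (O : ValuationSubring K),
        (∀ c : k, algebraMap k K c ∈ O) → RelLocalUniformization k K O) ↔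
      ∀ (k K : Type) [Field k] [CharP k p] [Field K] [Algebra k K],
        (⊤ : IntermediateField k K).FG → ∀ O : ValuationSubring K,
          Nonempty O.valuation.RankOne → (∀ c : k, algebraMap k K c ∈ O) →
            RelMuPTorsorCoreStepsAt p k O := by
  constructor
  · intro h k K _ _ _ _ _ O _ hk
    refine relCoreStepsAt_of_relLocalUniformization O hk fun K' => h k K' _ fun c => ?_
    rw [ValuationSubring.mem_comap, ← IsScalarTower.algebraMap_apply]
    exact hk c
  · intro h k K _ _ _ _ O _
    exact relLocalUniformization_of_rankOne_relCoreSteps hT₁ hCP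
      (fun K _ _ hfg O hr hk => h k K hfg O hr hk) K O

/-- **Local uniformization in characteristic `p` from the core steps at rank-one valuation
rings** (Temkin height one + Cossart–Piltant dim `≤ 3` + Cutkosky + Novacoski–Spivakovsky).
[cite: NovacoskiSpivakovsky2014, Thm. 1.1; Temkin2013, Section 4.1; CossartPiltant2019, Thm. 1.1; Cutkosky2022, Thm. 1.3] -/
theorem localUniformizationInChar_of_rankOne_relCoreSteps [Fact p.Prime]
    (hT₁ : Temkin2013HeightLeOne.{0}) (hCP : CossartPiltant2019LU3.{0})
    (H : ∀ (k K : Type) [Field k] [CharP k p] [Field K] [Algebra k K],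
      (⊤ : IntermediateField k K).FG → ∀ O : ValuationSubring K,
        Nonempty O.valuation.RankOne → (∀ c : k, algebraMap k K c ∈ O) →
          RelMuPTorsorCoreStepsAt p k O) :
    LocalUniformizationInChar.{0} p := fun k K _ _ _ _ hfg O hk =>
  isLocallyUniformizable_of_relLocalUniformization hfg O hk
    (relLocalUniformization_of_rankOne_relCoreSteps hT₁ hCP
      (fun K _ _ hfg O hr hk => H k K hfg O hr hk) K O)

end Global

end Literature.AlgebraicGeometry.Resolution

end
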